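/-
Copyright: lit-balaban cell, Phase-2 proof seat p02 (gen 8).  Statement-level skeleton of a published paper; no proof claims beyond what
the kernel checks below.
-/
import Literature.MathematicalPhysics.QuantumFieldTheory.BalabanImbrieJaffe1984to88.BIJ88HkLocTorus
import Literature.MathematicalPhysics.QuantumFieldTheory.BalabanImbrieJaffe1984to88.BIJ88Decay216Prop12

/-!
# `BalabanImbrieJaffe1984to88.BIJ88Ineq555W3CorrMechanism` — T. Bałaban, J. Imbrie, A. Jaffe, *Effective action and cluster properties
of the abelian Higgs model*, Commun. Math. Phys. **114** (1988) 257–315 [BalabanImbrieJaffe1988]: **the mechanism behind (5.5.5) p. 284 for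
the second kernel `w″₃`** — the *"usual method for obtaining formulas for localized kernels"* applied to the correction
`w″₃ − w′₃ = Q^e_k∂^η(H_kΛ₂^{(k)*}□ − H_{k,loc}Λ₂^{(k)*})` of (5.5.4) AT ONE FINE PLAQUETTE OF THE TORUS, UNIFORMLY IN `k`: discrete
Leibniz for the `η`-curl of the bracket column `G_b(b″) = H_k(b″,b)χ_{□(p)}(b) − H_{k,loc}(b″,b) = (χ_{□(p)}(b) − ζ_k(b″,b))·H_k(b″,b)`
((2.4) `H_{k,loc} = ζ_kH_k`), the GRADIENT member of (I.7.2.2) for the column (`|∂^ηH_k(·,b)(q)| ≤ 2Me^{−δ dist}`, no `η⁻¹`), a Lipschitz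
constant for the (2.1) cutoff (*"ζ_k is a smooth function of b"*: `η⁻¹|ζ_k(b₁,b) − ζ_k(b_i,b)| ≤ K` across adjacent fine bonds) and the cube
clause *"□ is centered near the plaquette that we are evaluating at"*.  Companion file `BIJ88Ineq555W3CorrTorus` (same seat) sums this
over the face `B^e_k(p)` of the edge average `Q^e_k` and instantiates it for the kernels of record given only [6I] Proposition 1.2.

statement-level skeleton of published theorems with citation tags; proofs where landed; nothing here is a claim about the Yang–Mills mass gap

PDF held: `paper:balaban1988-cmp114-bij-abelian-higgs-effective-action` (journal page = PDF page + 256).  Page read this session AS AN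
IMAGE: p. 284 [PDF 28] (`HOME/lit-balaban-r16/renders/cmp114/original-p028-x2.png`); p. 260 [PDF 4] ((2.1), (2.4)) through p08 g7's verbatim
quotation in `BIJ88HkLocTorus`.

CITATION HEADER (lean-in-tree rule).  Part of the lit-balaban TYPED SKELETON (HOME `run/shared/lean/pub/lit-balaban/`), Phase-2 proof seat
p02 (gen 8), unit `lit-balaban-p02-g8`; WHAT IS REPRODUCED = the mechanism of SKELETON row **C2.Eq5.5.5** (owner r16, referee ref-5) for
`w″₃` (TAKING line HOME/STATUS.md 2026-08-21T21:40:42Z).  Decls of record used BY NAME (nothing restated): p09's `distEU`/`ctr`/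
`supDist_triangle`/`supDist_ctr_ctr`/`supDist_runSite_le`, p08 g8's `BIJ88Decay216Torus.distEU_sub_le`/`supDist_ctr_le_of_mem`, p31's
`BIJ85Eq224Base0.torusEdgeCellsTo`, p13's `BIJ88Cutoffs21.cutoff`/`cutoffProfile`, r18's `BIJ88Sect2Statements.loc`/`IsCutoff`, Mathlib's
`Real.smoothTransition`.

THE PRINTED TEXT (p. 284 [PDF 28], read as an image, verbatim): *"= Q^e_k∂^ηH_kΛ₂^{(k)*}□A^{(k)} + w′₃A^{(k)} = Q^e_k∂^ηH_{k,loc}Λ₂^{(k)*}A^{(k)} +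
w″₃A^{(k)}. (5.5.4) The ½r(e_k)-cube □ is centered near the plaquette that we are evaluating σ_{k,loc}∂Λ₂^{(k)*}A^{(k)} at. The kernels w′₃, w″₃
have range less than ½r(e_k), and we have |w′₃(p,b)|, |w″₃(p,b)| ≦ e^{−cr(e_k)}. (5.5.5) In (5.5.4) we have applied our usual method for
obtaining formulas for localized kernels analogous to those valid for unlocalized ones [in this case, (5.5.1)]."*  p. 260 (2.1): *"Construct
a translation invariant localization function ζ_k such that ζ_k(b,b′) = 0, if dist(b,b′) ≧ ⅛r(e_k), 1, if dist(b,b′) ≦ (1/16)r(e_k), (2.1) and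
such that ζ_k is a smooth function of b."*; (2.4): *"H_{k,loc}(b,b′) = ζ_k(b,b′)H_k(b,b′)."*

WHAT IS PROVED (0 `sorry`, standard axioms; theorems only — proof lane):
* §1 `curl_mul_eq`, `abs_curl_mul_le` — discrete Leibniz for the curl of a product of bond fields at one plaquette (any torus level).
* §2 `exists_lipschitz_cutoffProfile` — p13's profile is Lipschitz, `|ζ(s) − ζ(t)| ≤ (C/(R₀ − R₁))|s − t|` (Mathlib's `Real.smoothTransition` is
  `C¹` with derivative supported in `[0,1]`; the argument of `Literature.Topology.FourManifolds.RadialLinearization`, re-proved privately to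
  keep the import cone small); `lip_cutoff_torus` — at thresholds `(r/16, r/8)`, `r ≥ 16`: `L^k|ζ_k(⟨x,λ⟩,b) − ζ_k(⟨x′,λ′⟩,b)| ≤ C` for `|x − x′|_∞ ≤ 1`.
* §3 torus geometry: `abs_distEU_sub_le_of_supDist_le_one` (adjacent fine sites), `supDist_coarse_le` (`|y − z|_∞ ≤ dist(x,y) + dist(x,z)`),
  `distEU_le_half_of_mem_edgeB` (`q ∈ B^e_k(p) ⇒ dist(q₋, p₋) ≤ ½`), `le_distEU_of_far` / `zeta_eq_zero_of_far` (off the cube every bond of the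
  face is at distance `≥ r/8` from `b`, so the cutoff vanishes there).
* §4 `rem_term_le`, `bracket_eq_mul`, **`abs_curl_bracket_le`** — `|∂^ηG_b(q)| ≤ (2 + 3Ke^δ)·M·e^{−δr/16}` for every fine plaquette `q` of the
  face `B^e_k(p)`, for ANY column family `H` with `|H(b″,b)| ≤ Me^{−δ dist(b″,b)}` and `|∂^ηH(·,b)(q)| ≤ 2Me^{−δ dist(q₋,b₋)}`, ANY (2.1)-cutoff
  `0 ≤ ζ ≤ 1` with `η⁻¹`-Lipschitz constant `K`, any `|χ□| ≤ 1` with `□(p) ⊇ {b : |p₋ − b₋|_∞ ≤ r/8 + 2}`.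
HONEST SCOPE.  (i) One fine plaquette; the hypotheses are the displayed (I.7.2.2)-type bounds on the column and its η-curl (supplied for the
`H_k` of record in the companion file) and the (2.1) shape of the cutoff.  (ii) `□(p)` typed by the containment clause (p36's reading of
*"centered near the plaquette"*).  (iii) Unscaled fine-site distance `distEU` of (I.7.2.2); constants explicit; `U = 1` real abelian fields;
torus; standing range; `2 ≤ d`.  (iv) No `def`, no new named fact: theorems only; NOT summit progress.  Unit `lit-balaban-p02-g8`
(literature-prover-lit-balaban-p02-g8-0), 2026-08-21.
-/

open scoped BigOperators Topology

namespace Literature.MathematicalPhysics.QuantumFieldTheory.BalabanImbrieJaffe1984to88.BIJ88Ineq555W3CorrMechanism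

open Balaban1983to89 hiding Site Plaq
open Balaban1983to89.LatticeFieldCalculus
open Balaban1983to89.B3TorusRadialSums (supDist_comm supDist_eq_zero_iff)
open BIJ85Ineq722Torus
open BIJ88Sect2Statements (loc IsCutoff)
open BIJ88Cutoffs21 (cutoff cutoffProfile cutoff_apply)
open BIJ85Eq224Base0 (torusEdgeCellsTo)
open BIJ88Decay216Torus (distEU_sub_le supDist_ctr_le_of_mem)

open Balaban1983to89 renaming Site → TSite, Plaq → TPlaq

noncomputable section

variable {P : Params}

/-! ## §1  Discrete Leibniz for the curl of a product at one plaquette -/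

/-- **discrete Leibniz**: `∂^c((fg))(q) = f(b₁)·(∂^cg)(q) + c·((f(b₂) − f(b₁))g(b₂) − (f(b₃) − f(b₁))g(b₃) − (f(b₄) − f(b₁))g(b₄))` for the
four boundary bonds `b₁ = ⟨x,μ⟩, b₂ = ⟨x+e_μ,ν⟩, b₃ = ⟨x+e_ν,μ⟩, b₄ = ⟨x,ν⟩` of `q = (x; μ < ν)`. [cite: BalabanImbrieJaffe1985, (2.5) p.302] -/
theorem curl_mul_eq {j : ℕ} (c : ℝ) (f g : VecField P j ℝ) (q : TPlaq P j) :
    curl c (fun b => f b * g b) q =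
      f ⟨q.src, q.μ⟩ * curl c g q +
        c * ((f ⟨q.src.shift q.μ, q.ν⟩ - f ⟨q.src, q.μ⟩) * g ⟨q.src.shift q.μ, q.ν⟩
            - (f ⟨q.src.shift q.ν, q.μ⟩ - f ⟨q.src, q.μ⟩) * g ⟨q.src.shift q.ν, q.μ⟩
            - (f ⟨q.src, q.ν⟩ - f ⟨q.src, q.μ⟩) * g ⟨q.src, q.ν⟩) := by
  simp only [curl, smul_eq_mul]
  ring

/-- **`|∂^c(fg)(q)| ≤ |f(b₁)|·|∂^cg(q)| + |c|·Σ_{i=2,3,4}|f(b_i) − f(b₁)|·|g(b_i)|`**. [cite: BalabanImbrieJaffe1985, (2.5) p.302] -/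
theorem abs_curl_mul_le {j : ℕ} (c : ℝ) (f g : VecField P j ℝ) (q : TPlaq P j) :
    |curl c (fun b => f b * g b) q| ≤
      |f ⟨q.src, q.μ⟩| * |curl c g q| +
        |c| * (|f ⟨q.src.shift q.μ, q.ν⟩ - f ⟨q.src, q.μ⟩| * |g ⟨q.src.shift q.μ, q.ν⟩|
              + |f ⟨q.src.shift q.ν, q.μ⟩ - f ⟨q.src, q.μ⟩| * |g ⟨q.src.shift q.ν, q.μ⟩|
              + |f ⟨q.src, q.ν⟩ - f ⟨q.src, q.μ⟩| * |g ⟨q.src, q.ν⟩|) := by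
  rw [curl_mul_eq]
  refine (abs_add_le _ _).trans ?_
  rw [abs_mul, abs_mul]
  refine add_le_add le_rfl (mul_le_mul_of_nonneg_left ?_ (abs_nonneg c))
  rw [← abs_mul, ← abs_mul, ← abs_mul]
  exact (abs_sub _ _).trans (add_le_add (abs_sub _ _) le_rfl)

/-! ## §2  A Lipschitz constant for the (2.1) cutoff profile -/

section Lipschitz

open Set Filter

/-- the derivative of Mathlib's smooth transition vanishes off `[0, 1]` (it is constant there). [folklore] -/
private theorem deriv_smoothTransition_eq_zero {x : ℝ} (hx : x < 0 ∨ 1 < x) : deriv Real.smoothTransition x = 0 := by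
  rcases hx with hx | hx
  · have h : Real.smoothTransition =ᶠ[𝓝 x] fun _ => (0 : ℝ) :=
      (eventually_lt_nhds hx).mono fun y hy => Real.smoothTransition.zero_of_nonpos hy.le
    rw [h.deriv_eq, deriv_const]
  · have h : Real.smoothTransition =ᶠ[𝓝 x] fun _ => (1 : ℝ) :=
      (eventually_gt_nhds hx).mono fun y hy => Real.smoothTransition.one_of_one_le hy.le
    rw [h.deriv_eq, deriv_const]

/-- the smooth transition is globally Lipschitz (its derivative is continuous and vanishes off the compact `[0,1]`; the argument of
`Literature.Topology.FourManifolds.RadialLinearization.exists_lipschitz_smoothTransition`, re-proved to keep the import cone small). [folklore] -/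
private theorem exists_lipschitz_smoothTransition :
    ∃ C : ℝ, 0 < C ∧ ∀ x y : ℝ, |Real.smoothTransition x - Real.smoothTransition y| ≤ C * |x - y| := by
  have hd : Continuous (deriv Real.smoothTransition) :=
    (Real.smoothTransition.contDiff (n := 1)).continuous_deriv le_rfl
  obtain ⟨C₀, hC₀⟩ := isCompact_Icc.exists_bound_of_continuousOn (s := Icc (0 : ℝ) 1) hd.continuousOn
  refine ⟨max C₀ 1, lt_max_of_lt_right one_pos, fun x y => ?_⟩
  have hb : ∀ z ∈ (univ : Set ℝ), ‖deriv Real.smoothTransition z‖ ≤ max C₀ 1 := by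
    intro z _
    by_cases hz : z ∈ Icc (0 : ℝ) 1
    · exact (hC₀ z hz).trans (le_max_left _ _)
    · rw [mem_Icc, not_and_or, not_le, not_le] at hz
      rw [deriv_smoothTransition_eq_zero hz, norm_zero]
      exact le_trans zero_le_one (le_max_right _ _)
  have h := Convex.norm_image_sub_le_of_norm_deriv_le (𝕜 := ℝ) (f := Real.smoothTransition)
    (fun z _ => (Real.smoothTransition.contDiff (n := 1)).contDiffAt.differentiableAt one_ne_zero) hb
    convex_univ (mem_univ y) (mem_univ x)
  simpa [Real.norm_eq_abs] using h

/-- **p13's (2.1) profile is Lipschitz**: `|ζ(s) − ζ(t)| ≤ (C/(R₀ − R₁))·|s − t|` for `cutoffProfile R₁ R₀ = smoothTransition((R₀ − ·)/(R₀ − R₁))`,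
one `C > 0` for all thresholds `R₁ < R₀` — the quantitative form of *"ζ_k is a smooth function of b"*. [cite: BalabanImbrieJaffe1988, (2.1) p.260] -/
theorem exists_lipschitz_cutoffProfile :
    ∃ C : ℝ, 0 < C ∧ ∀ (R₁ R₀ : ℝ), R₁ < R₀ → ∀ s t : ℝ,
      |cutoffProfile R₁ R₀ s - cutoffProfile R₁ R₀ t| ≤ C / (R₀ - R₁) * |s - t| := by
  obtain ⟨C, hC, h⟩ := exists_lipschitz_smoothTransition
  refine ⟨C, hC, fun R₁ R₀ hR s t => ?_⟩
  have hd : 0 < R₀ - R₁ := sub_pos.2 hR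
  unfold cutoffProfile
  refine (h _ _).trans (le_of_eq ?_)
  rw [← sub_div, show R₀ - s - (R₀ - t) = t - s by ring, abs_div, abs_of_pos hd, abs_sub_comm t s]
  field_simp

end Lipschitz

/-! ## §3  Torus geometry: adjacent fine sites, coarse versus fine distance, the face `B^e_k(p)`; p13's cutoff is `η⁻¹`-Lipschitz -/

/-- `0 < L^k` (real form). [folklore] -/
private theorem cast_pow_L_pos' (k : ℕ) : (0 : ℝ) < (P.L : ℝ) ^ k := by
  have hL1 : (1 : ℝ) ≤ (P.L : ℝ) := by exact_mod_cast P.L_pos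
  positivity

/-- `|x − (x + e_μ)|_∞ ≤ 1`. [folklore] -/
private theorem supDist_shift_le {j : ℕ} (x : TSite P j) (μ : Fin P.d) : supDist x (x.shift μ) ≤ 1 := by
  have h := supDist_runSite_le x μ 1
  have h2 : runSite x μ 1 = x.shift μ := by
    show Function.update x μ (x μ + ((1 : ℕ) : ZMod _)) = Function.update x μ (x μ + 1)
    rw [Nat.cast_one]
  rwa [h2] at h

/-- `1/L^k ≤ 1`. [folklore] -/
private theorem one_div_pow_L_le_one (k : ℕ) : 1 / (P.L : ℝ) ^ k ≤ 1 := by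
  have hL1 : (1 : ℝ) ≤ (P.L : ℝ) := by exact_mod_cast P.L_pos
  rw [div_le_one (cast_pow_L_pos' k)]
  exact one_le_pow₀ hL1

/-- **adjacent fine sites see almost the same distance**: `|dist(x′, y) − dist(x, y)| ≤ |x − x′|_∞/L^k ≤ 1/L^k` for `|x − x′|_∞ ≤ 1`
(`dist = distEU`, the fine-site distance of (I.7.2.2) in the unit of `T₁^{(k)}`). [cite: BalabanImbrieJaffe1985, (7.2.2) p.325] -/
theorem abs_distEU_sub_le_of_supDist_le_one {k : ℕ} {x x' : TSite P 0} (h : supDist x x' ≤ 1) (y : TSite P k) :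
    |distEU P k x' y - distEU P k x y| ≤ 1 / (P.L : ℝ) ^ k := by
  have hL := cast_pow_L_pos' (P := P) k
  have h1 : (supDist x x' : ℝ) ≤ 1 := by exact_mod_cast h
  rw [abs_sub_le_iff]
  constructor
  · exact (distEU_sub_le k x x' y).trans (div_le_div_of_nonneg_right h1 hL.le)
  · refine (distEU_sub_le k x' x y).trans (div_le_div_of_nonneg_right ?_ hL.le)
    rw [supDist_comm]; exact h1

/-- **coarse distance from fine distances**: `|y − z|_∞ ≤ dist(x, y) + dist(x, z)` (unit of `T₁^{(k)}`; the block centres realize the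
coarse distance, `supDist_ctr_ctr`). [cite: BalabanImbrieJaffe1985, (7.2.2) p.325] -/
theorem supDist_coarse_le {k : ℕ} (hk : k ≤ P.m + P.K) (x : TSite P 0) (y z : TSite P k) :
    (supDist y z : ℝ) ≤ distEU P k x y + distEU P k x z := by
  have hL := cast_pow_L_pos' (P := P) k
  rw [distEU, distEU, ← add_div, le_div_iff₀ hL]
  have h1 := supDist_triangle (ctr k y) x (ctr k z)
  rw [supDist_comm (ctr k y) x, supDist_ctr_ctr hk] at h1
  have h2 : ((P.L ^ k * supDist y z : ℕ) : ℝ) ≤ ((supDist x (ctr k y) + supDist x (ctr k z) : ℕ) : ℝ) := by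
    exact_mod_cast h1
  push_cast at h2
  linarith

/-- **a fine plaquette of the face `B^e_k(p)` lies within `½` of `p`**: `q ∈ B^e_k(p) ⇒ dist(q₋, p₋) ≤ ½` (`|q₋ − y_{p₋}|_∞ ≤ (L^k − 1)/2`,
p08's `supDist_ctr_le_of_mem`). [cite: BalabanImbrieJaffe1985, (2.21) p.305] -/
theorem distEU_le_half_of_mem_edgeB (hd : 2 ≤ P.d) {k : ℕ} (hk : k ≤ P.m + P.K) {p : TPlaq P k} {q : TPlaq P 0}
    (h : q ∈ (torusEdgeCellsTo P 0 k k (Nat.zero_add k) hd).B p) : distEU P k q.src p.src ≤ 1 / 2 := by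
  have hL := cast_pow_L_pos' (P := P) k
  have h1 := supDist_ctr_le_of_mem hd hk h
  rw [distEU, div_le_iff₀ hL]
  have h2 : (supDist q.src (ctr k p.src) : ℝ) ≤ (((P.L ^ k - 1) / 2 : ℕ) : ℝ) := by exact_mod_cast h1
  have h3 : (((P.L ^ k - 1) / 2 : ℕ) : ℝ) ≤ ((P.L ^ k - 1 : ℕ) : ℝ) / 2 := Nat.cast_div_le
  have h4 : ((P.L ^ k - 1 : ℕ) : ℝ) ≤ (P.L : ℝ) ^ k := by
    have : P.L ^ k - 1 ≤ P.L ^ k := Nat.sub_le _ _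
    exact_mod_cast this
  linarith

/-- **off the cube the bonds of the face are far from `b`**: if `|p₋ − b₋|_∞ > r/8 + 2` and `q ∈ B^e_k(p)`, every fine site `x` within one
lattice step of `q₋` has `dist(x, b₋) ≥ r/8`. [cite: BalabanImbrieJaffe1988, (5.5.5) p.284] -/
theorem le_distEU_of_far (hd : 2 ≤ P.d) {k : ℕ} (hk : k ≤ P.m + P.K) {r : ℝ} {p : TPlaq P k} {q : TPlaq P 0}
    (hq : q ∈ (torusEdgeCellsTo P 0 k k (Nat.zero_add k) hd).B p) {y : TSite P k}
    (hfar : r / 8 + 2 < (supDist p.src y : ℝ)) {x : TSite P 0} (hx : supDist q.src x ≤ 1) : r / 8 ≤ distEU P k x y := by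
  have h1 := distEU_le_half_of_mem_edgeB hd hk hq
  have h2 := abs_distEU_sub_le_of_supDist_le_one hx p.src
  have h3 := one_div_pow_L_le_one (P := P) k
  have h4 := supDist_coarse_le hk x p.src y
  rw [abs_le] at h2
  linarith

/-- **… so a (2.1)-cutoff vanishes there**: `ζ(⟨x, λ⟩, b) = 0` for such `x` (`ζ = 0` beyond `r/8`). [cite: BalabanImbrieJaffe1988, (2.1) p.260] -/
theorem zeta_eq_zero_of_far (hd : 2 ≤ P.d) {k : ℕ} (hk : k ≤ P.m + P.K) {r : ℝ} {ζ : PBond P 0 → PBond P k → ℝ}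
    (hcut : IsCutoff (fun (b'' : PBond P 0) (b' : PBond P k) => distEU P k b''.src b'.src) ζ (r / 16) (r / 8))
    {p : TPlaq P k} {q : TPlaq P 0} (hq : q ∈ (torusEdgeCellsTo P 0 k k (Nat.zero_add k) hd).B p) {b : PBond P k}
    (hfar : r / 8 + 2 < (supDist p.src b.src : ℝ)) {x : TSite P 0} (hx : supDist q.src x ≤ 1) (lam : Fin P.d) :
    ζ ⟨x, lam⟩ b = 0 :=
  hcut.2 ⟨x, lam⟩ b (le_distEU_of_far hd hk hq hfar hx)

/-- **p13's constructed (2.1) cutoff is `η⁻¹`-Lipschitz across adjacent fine bonds**: at thresholds `(r/16, r/8)`, `r ≥ 16`,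
`L^k|ζ_k(⟨x,λ⟩,b) − ζ_k(⟨x′,λ′⟩,b)| ≤ C` for `|x − x′|_∞ ≤ 1` (`C` the profile constant of §2: slope `C/(r/16) ≤ C`, step `1/L^k`).
[cite: BalabanImbrieJaffe1988, (2.1) p.260] -/
theorem lip_cutoff_torus {k : ℕ} {C r : ℝ} (hC : 0 ≤ C) (hr : 16 ≤ r)
    (hLip : ∀ s t, |cutoffProfile (r / 16) (r / 8) s - cutoffProfile (r / 16) (r / 8) t| ≤ C / (r / 8 - r / 16) * |s - t|)
    (x x' : TSite P 0) (lam lam' : Fin P.d) (b : PBond P k) (hxx' : supDist x x' ≤ 1) :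
    (P.L : ℝ) ^ k * |cutoff (r / 16) (r / 8) (fun (b'' : PBond P 0) (b' : PBond P k) => distEU P k b''.src b'.src) ⟨x, lam⟩ b -
        cutoff (r / 16) (r / 8) (fun (b'' : PBond P 0) (b' : PBond P k) => distEU P k b''.src b'.src) ⟨x', lam'⟩ b| ≤ C := by
  have hL := cast_pow_L_pos' (P := P) k
  have hD := abs_distEU_sub_le_of_supDist_le_one hxx' b.src
  have hC' : C / (r / 8 - r / 16) ≤ C := by
    rw [div_le_iff₀ (by linarith : (0 : ℝ) < r / 8 - r / 16)]
    nlinarith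
  simp only [cutoff_apply]
  calc (P.L : ℝ) ^ k * |cutoffProfile (r / 16) (r / 8) (distEU P k x b.src) - cutoffProfile (r / 16) (r / 8) (distEU P k x' b.src)|
      ≤ (P.L : ℝ) ^ k * (C / (r / 8 - r / 16) * |distEU P k x b.src - distEU P k x' b.src|) :=
        mul_le_mul_of_nonneg_left (hLip _ _) hL.le
    _ ≤ (P.L : ℝ) ^ k * (C * (1 / (P.L : ℝ) ^ k)) := by
        refine mul_le_mul_of_nonneg_left (mul_le_mul hC' ?_ (abs_nonneg _) hC) hL.le
        rwa [abs_sub_comm]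
    _ = C := by field_simp

/-! ## §4  The bracket `G_b = H_kΛ₂□ − H_{k,loc}Λ₂` column and its η-curl -/

/-- **one Leibniz remainder term**: `η⁻¹|ζ(⟨x,λ⟩,b) − ζ(⟨x′,λ′⟩,b)|·|g| ≤ K·M·e^{δ}·e^{−δr/16}` for adjacent `x, x′`, `|g| ≤ Me^{−δ dist(x′,b)}`,
an `η⁻¹`-Lipschitz (2.1)-cutoff (`= 1` within `r/16`: the difference vanishes unless `dist(x′, b) > r/16 − 1`). [cite: BalabanImbrieJaffe1988, (5.5.5) p.284] -/
theorem rem_term_le {k : ℕ} {δ M K r : ℝ} (hδ : 0 ≤ δ) (hM : 0 ≤ M) (hK : 0 ≤ K) {ζ : PBond P 0 → PBond P k → ℝ}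
    (hcut : IsCutoff (fun (b'' : PBond P 0) (b' : PBond P k) => distEU P k b''.src b'.src) ζ (r / 16) (r / 8))
    {x x' : TSite P 0} {lam lam' : Fin P.d} {b : PBond P k}
    (hLip : (P.L : ℝ) ^ k * |ζ ⟨x, lam⟩ b - ζ ⟨x', lam'⟩ b| ≤ K) (hxx' : supDist x x' ≤ 1) {g : ℝ}
    (hg : |g| ≤ M * Real.exp (-(δ * distEU P k x' b.src))) :
    (P.L : ℝ) ^ k * |ζ ⟨x, lam⟩ b - ζ ⟨x', lam'⟩ b| * |g| ≤ K * M * Real.exp δ * Real.exp (-(δ * (r / 16))) := by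
  by_cases hin : distEU P k x b.src ≤ r / 16 ∧ distEU P k x' b.src ≤ r / 16
  · have e1 : ζ ⟨x, lam⟩ b = 1 := hcut.1 ⟨x, lam⟩ b hin.1
    have e2 : ζ ⟨x', lam'⟩ b = 1 := hcut.1 ⟨x', lam'⟩ b hin.2
    rw [e1, e2, sub_self, abs_zero, mul_zero, zero_mul]
    positivity
  · have hD := abs_distEU_sub_le_of_supDist_le_one hxx' b.src
    have h3 := one_div_pow_L_le_one (P := P) k
    have hfar : r / 16 - 1 < distEU P k x' b.src := by
      by_contra hcon
      rw [not_lt] at hcon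
      rw [abs_le] at hD
      exact hin ⟨by linarith, by linarith⟩
    have hg' : |g| ≤ M * (Real.exp δ * Real.exp (-(δ * (r / 16)))) := by
      refine hg.trans (mul_le_mul_of_nonneg_left ?_ hM)
      rw [← Real.exp_add]
      refine Real.exp_le_exp.2 ?_
      have := mul_le_mul_of_nonneg_left hfar.le hδ
      linarith
    calc (P.L : ℝ) ^ k * |ζ ⟨x, lam⟩ b - ζ ⟨x', lam'⟩ b| * |g| ≤ K * |g| := mul_le_mul_of_nonneg_right hLip (abs_nonneg g)
      _ ≤ K * (M * (Real.exp δ * Real.exp (-(δ * (r / 16))))) := mul_le_mul_of_nonneg_left hg' hK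
      _ = K * M * Real.exp δ * Real.exp (-(δ * (r / 16))) := by ring

/-- **the bracket column is a product**: `H_k(b″,b)χ□(b) − (ζ_kH_k)(b″,b) = (χ□(b) − ζ_k(b″,b))·H_k(b″,b)` ((2.4) `H_{k,loc} = ζ_kH_k`).
[cite: BalabanImbrieJaffe1988, (2.4) p.260] -/
theorem bracket_eq_mul {k : ℕ} (ζ : PBond P 0 → PBond P k → ℝ) (H : PBond P k → VecField P 0 ℝ) (χ : ℝ) (b : PBond P k) :
    (fun b'' => H b b'' * χ - loc ζ (fun b'' b' => H b' b'') b'' b) = fun b'' => (χ - ζ b'' b) * H b b'' := by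
  funext b''
  simp only [loc]
  ring

/-- **`|∂^ηG_b(q)| ≤ (2 + 3Ke^δ)·M·e^{−δr/16}` for every fine plaquette `q` of the face `B^e_k(p)`** — the *"usual method"* at one
plaquette, uniform in `k`: columns `|H(b″,b)| ≤ Me^{−δ dist(b″,b)}` whose `η`-curl obeys the GRADIENT bound `|∂^ηH(·,b)(q)| ≤ 2Me^{−δ dist(q₋,b₋)}`,
any (2.1)-cutoff `0 ≤ ζ ≤ 1` with `η⁻¹`-Lipschitz constant `K` across adjacent fine bonds, `|χ□| ≤ 1`, and the cube clause
`□(p) ⊇ {b : |p₋ − b₋|_∞ ≤ r/8 + 2}`. [cite: BalabanImbrieJaffe1988, (5.5.5) p.284] -/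
theorem abs_curl_bracket_le (hd : 2 ≤ P.d) {k : ℕ} (hk : k ≤ P.m + P.K) {H : PBond P k → VecField P 0 ℝ} {δ M : ℝ}
    (hδ : 0 ≤ δ) (hM : 0 ≤ M) (hH : ∀ b b'', |H b b''| ≤ M * Real.exp (-(δ * distEU P k b''.src b.src)))
    (hcurl : ∀ b q, |curl ((P.L : ℝ) ^ k) (H b) q| ≤ 2 * M * Real.exp (-(δ * distEU P k q.src b.src)))
    {r K : ℝ} (hr : 0 < r) (hK : 0 ≤ K) {ζ : PBond P 0 → PBond P k → ℝ}
    (hcut : IsCutoff (fun (b'' : PBond P 0) (b' : PBond P k) => distEU P k b''.src b'.src) ζ (r / 16) (r / 8))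
    (h01 : ∀ b'' b', 0 ≤ ζ b'' b' ∧ ζ b'' b' ≤ 1)
    (hLipζ : ∀ (x x' : TSite P 0) (lam lam' : Fin P.d) (b' : PBond P k), supDist x x' ≤ 1 →
      (P.L : ℝ) ^ k * |ζ ⟨x, lam⟩ b' - ζ ⟨x', lam'⟩ b'| ≤ K)
    {χb : TPlaq P k → PBond P k → ℝ} (hχb : ∀ p b, |χb p b| ≤ 1)
    (hbox : ∀ p b, (supDist p.src b.src : ℝ) ≤ r / 8 + 2 → χb p b = 1)
    {p : TPlaq P k} {q : TPlaq P 0} (hq : q ∈ (torusEdgeCellsTo P 0 k k (Nat.zero_add k) hd).B p) (b : PBond P k) :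
    |curl ((P.L : ℝ) ^ k) (fun b'' => H b b'' * χb p b - loc ζ (fun b'' b' => H b' b'') b'' b) q| ≤
      (2 + 3 * K * Real.exp δ) * M * Real.exp (-(δ * (r / 16))) := by
  have hL := cast_pow_L_pos' (P := P) k
  rw [bracket_eq_mul ζ H (χb p b) b]
  have main := abs_curl_mul_le ((P.L : ℝ) ^ k) (fun b'' => χb p b - ζ b'' b) (H b) q
  beta_reduce at main
  have hsub : ∀ b₁ b₂ : PBond P 0, (χb p b - ζ b₂ b) - (χb p b - ζ b₁ b) = ζ b₁ b - ζ b₂ b := fun _ _ => by ring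
  rw [hsub, hsub, hsub, abs_of_pos hL] at main
  -- adjacency of the four boundary bonds to `b₁ = ⟨q₋, μ⟩`
  have hs0 : supDist q.src q.src ≤ 1 := by rw [(supDist_eq_zero_iff _ _).2 rfl]; exact zero_le_one
  have hs1 : supDist q.src (q.src.shift q.μ) ≤ 1 := supDist_shift_le _ _
  have hs2 : supDist q.src (q.src.shift q.ν) ≤ 1 := supDist_shift_le _ _
  -- the three Leibniz remainder terms
  have T2 := rem_term_le hδ hM hK hcut (hLipζ _ _ q.μ q.ν b hs1) hs1 (hH b ⟨q.src.shift q.μ, q.ν⟩)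
  have T3 := rem_term_le hδ hM hK hcut (hLipζ _ _ q.μ q.μ b hs2) hs2 (hH b ⟨q.src.shift q.ν, q.μ⟩)
  have T4 := rem_term_le hδ hM hK hcut (hLipζ _ _ q.μ q.ν b hs0) hs0 (hH b ⟨q.src, q.ν⟩)
  -- the main term: non-zero only at distance `≥ r/16` from `b`
  have hmono : ∀ {t : ℝ}, r / 16 ≤ t → Real.exp (-(δ * t)) ≤ Real.exp (-(δ * (r / 16))) := fun ht =>
    Real.exp_le_exp.2 (by nlinarith)
  have T1 : |χb p b - ζ ⟨q.src, q.μ⟩ b| * |curl ((P.L : ℝ) ^ k) (H b) q| ≤ 2 * M * Real.exp (-(δ * (r / 16))) := by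
    by_cases h1 : χb p b = 1
    · by_cases hf : χb p b - ζ ⟨q.src, q.μ⟩ b = 0
      · rw [hf, abs_zero, zero_mul]; positivity
      · have hne : ¬ distEU P k q.src b.src ≤ r / 16 := fun hle => hf (by rw [h1, hcut.1 ⟨q.src, q.μ⟩ b hle, sub_self])
        have hf1 : |χb p b - ζ ⟨q.src, q.μ⟩ b| ≤ 1 := by
          rw [h1, abs_le]
          constructor <;> linarith [(h01 ⟨q.src, q.μ⟩ b).1, (h01 ⟨q.src, q.μ⟩ b).2]
        calc |χb p b - ζ ⟨q.src, q.μ⟩ b| * |curl ((P.L : ℝ) ^ k) (H b) q|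
            ≤ 1 * (2 * M * Real.exp (-(δ * distEU P k q.src b.src))) := mul_le_mul hf1 (hcurl b q) (abs_nonneg _) zero_le_one
          _ ≤ 2 * M * Real.exp (-(δ * (r / 16))) := by
              rw [one_mul]; exact mul_le_mul_of_nonneg_left (hmono (not_le.1 hne).le) (by positivity)
    · have hfar : r / 8 + 2 < (supDist p.src b.src : ℝ) := by
        by_contra hcon
        exact h1 (hbox p b (not_lt.1 hcon))
      have hz : ζ ⟨q.src, q.μ⟩ b = 0 := zeta_eq_zero_of_far hd hk hcut hq hfar hs0 q.μ
      have hd8 : r / 16 ≤ distEU P k q.src b.src := by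
        have := le_distEU_of_far hd hk hq hfar hs0; linarith
      rw [hz, sub_zero]
      calc |χb p b| * |curl ((P.L : ℝ) ^ k) (H b) q|
          ≤ 1 * (2 * M * Real.exp (-(δ * distEU P k q.src b.src))) := mul_le_mul (hχb p b) (hcurl b q) (abs_nonneg _) zero_le_one
        _ ≤ 2 * M * Real.exp (-(δ * (r / 16))) := by
            rw [one_mul]; exact mul_le_mul_of_nonneg_left (hmono hd8) (by positivity)
  refine main.trans ?_
  have e3 : (2 + 3 * K * Real.exp δ) * M * Real.exp (-(δ * (r / 16))) =
      2 * M * Real.exp (-(δ * (r / 16))) + (K * M * Real.exp δ * Real.exp (-(δ * (r / 16))) +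
        K * M * Real.exp δ * Real.exp (-(δ * (r / 16))) + K * M * Real.exp δ * Real.exp (-(δ * (r / 16)))) := by ring
  rw [e3, mul_add, mul_add]
  refine add_le_add T1 (add_le_add (add_le_add ?_ ?_) ?_)
  · rw [← mul_assoc]; exact T2
  · rw [← mul_assoc]; exact T3
  · rw [← mul_assoc]; exact T4

end

end Literature.MathematicalPhysics.QuantumFieldTheory.BalabanImbrieJaffe1984to88.BIJ88Ineq555W3CorrMechanism
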